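import Summits.QuantumFields.BalabanUV.Beta.D1BFx.SortedRelInv
import Summits.QuantumFields.BalabanUV.Beta.RelInvCombBorderedKKT
import Summits.QuantumFields.BalabanUV.Beta.BorderedHessianSymmetry

/-!
# `BalabanUV.Beta.D1BFx.TorusCombKKT` — road «BF-x», binder row D1, slot (K), debt X₃(ii) ROUTE T, brick **TB1 «M-SIDE ON THE TORUS»** PART 2:
# ON EVERY COARSE TORUS THE COMB-GAUGED SHARP KKT MATRIX `M_T := kkt K̂ (fromRows Q̂ τ_T)` IS INVERTIBLE AND THE ff BLOCK OF `M_T⁻¹` (the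
# fluctuation covariance `flucCov`) IS THE PERIODISATION OF THE Π_bm-DRESSED ONE-STEP RESOLVENT'S ff LEG — from the tree's `ℤ^{d+1}` relative
# rules (an2-g13 `RelInvBorderedHessian.relInv_coDressKBmAt_KInvStep_zero`), TA1 (`SortedKernels`∕`SortedReblocking`∕`SortedPack`), PART 1
# (`SortedRelInv.torus_relInv_rules_blocks`) and the row-D1 owner's finite bridge (an2-g23 `RelInvCombBorderedKKT`)

WHY (K-ASSEMBLY-SPEC v1 §1 TB1 «M_T invertible and the `(ν ⊕ μ)`-blocks of `M_T⁻¹` = periodisation of the Π_bm-dressed typed pack»; TB1-Q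
answered l.21263).  Here `K̂ := (fTL (sortK n (bhK n)))^` = the torus matrix of `d*d` (fine bonds × fine bonds), `Q̂ := (fBL (sortK n (bhK n)))^` = the
torus matrix of Bałaban's straight block averaging `𝒬` (coarse bonds × fine bonds), `τ_T` = the COORDINATE functional of the torus comb bonds
(`IsCombBondAt ρ n`), all over the coarse torus `Site (d+1) p` with the fine bonds re-blocked (`SortedReblocking`).
CONTENT (all [folklore]; every `d`, block side `n ≥ 1` with in-block root `toSite r`, coarse period `p ≥ 1`):
* §1 THE TORUS COMB FUNCTIONAL on `I := Site p × ((ℤ∕n)^{d+1} × Fin (d+1))`: `CombRows := {i // IsCombBondAt ρ n i.2.2 (repZ i.2.1)}` (comb-ness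
  read on the block of the origin), `tauT : Matrix CombRows I ℝ` (coordinate rows); `tauT_mul_transpose` (`τ·τᵀ = 1`), `transpose_mul_tauT_apply`.
* §2 `blocksHat_sortK_axEc : blocksHat p (sortK n (axEc ρ n)) = fromBlocks (1 − τ_Tᵀτ_T) 0 0 1` (`isCombBondAt_finePt_iff`: comb-ness depends
  only on the in-block position).
* §3 `blocksHat_sortK_bhK : blocksHat p (sortK n (bhK n)) = kkt K̂ Q̂ · fromBlocks 1 0 0 (−1)` (`trK_bhK`: `𝒬ᵀ`-corner carries the sign).
* §4 **`isUnit_det_MT`**, **`flucCov_MT_eq`** and **`inv_MT_packed_eq`**: `IsUnit (kkt K̂ (fromRows Q̂ τ_T)).det`,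
  `flucCov K̂ (fromRows Q̂ τ_T) = (reblock n (blk G true true))^` and `(M_T⁻¹).submatrix e e = diag(1,−1)·(sortK n G)^` (`e = Sum.map id Sum.inl`, TA4's
  `mixedVar_kkt_fromRows_zero` socket), `G := coDressKBmAt (toSite r) n (KInvStep n 0)` (= `KInv n`, `KInvStep_zero_eq`) —
  the relative rules periodised (PART 1 `torus_rules_wall`) + `A := diag(1,−1)·Ĝ` fed to `isUnit_det_kkt_fromRows_of_relInv` ∕ `blocks_kkt_fromRows_of_relInv`.
NOT HERE: the dictionary `KInv ↦ (Γ_R − d𝔅δ, ℋ_R, ℋ♭_R, wΦ)` (LANDED p234883; TB5 composes), the N-side (TB2), jets (TB4), traces (TA3).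

HONEST FRAMING (cell contract, verbatim): «discharging `BetaPertH` makes Bałaban's UV stability UNCONDITIONAL — a real constructive-QFT
result; it is NOT the continuum limit and NOT the Clay problem.»  HONEST DEPENDENCY (verbatim): «continuum YM on T⁴ ⇐ BetaPertH ∧ nine
spine estimates (0/9 proved); BetaPertH ⇐ (D1) ∧ (D4) ∧ CAP+tail; G-an2-4 gates asym, D1 and NE2/3/4.»  [folklore] bookkeeping + finite linear
algebra over tree objects BY NAME; no `Prop` is minted, nothing is cited, no wall binder is instantiated; 0 sorry.  NOT D1Rep, NOT D1, NOT BetaPertH.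
ABSOLUTE RULE (cell, verbatim): «No internally-minted statement may enter as a cited fact. Every hypothesis is either kernel-proved in this package
or a verbatim quotation of a PUBLISHED theorem with page reference. The manuscript(s) under audit are NOT citable for their own disputed steps — they
are the thing under adjudication; programme-internal (2001/route/tribunal) claims are never citable.»
Provenance: D1 formalisation swarm, unit `b2b-balaban-beta-d1-formalise-leaf-03` (gen 8), brick «K-TB1» part 2, 2026-08-20.
-/

noncomputable section

namespace Summit.QuantumFields.BalabanUV.Beta.D1BFx.TorusCombKKT

open Matrix
open Literature.Probability.LatticeModels (TorusSite Torus.proj Torus.proj_apply)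
open Literature.MathematicalPhysics.QuantumFieldTheory.LatticeForm (repZ quo proj_add_zsmul)
open Literature.MathematicalPhysics.QuantumFieldTheory.Balaban1983to89
open Literature.MathematicalPhysics.QuantumFieldTheory.Balaban1983to89.Beta
open Literature.MathematicalPhysics.QuantumFieldTheory.Balaban1983to89.Beta.Composition (kkt)
open Literature.MathematicalPhysics.QuantumFieldTheory.Balaban1983to89.Beta.CompositionSingular (flucCov)
open ExpKernelCalculus (MKer Decays comp shiftK)
open AffineAveraging (box toSite unitVec curv curvAdj contourSum)
open AffineReproduction (contourSumAdj)
open KKTFluctuationKernel (delta1 delta1_apply)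
open OneStepResolventKernel (Fib)
open OneStepKernelFamily (KInvStep)
open Summit.QuantumFields.BalabanUV.Beta.TameKernelCalculus (Spr trK trK_apply)
open Summit.QuantumFields.BalabanUV.Beta.ChartConjugationRelative (RelInv)
open Summit.QuantumFields.BalabanUV.Beta.AxialDressingRooted (cube IsCombBondAt coDressKBmAt axEc axEc_inl_inl axEc_inl_inr axEc_inr_inl
  axEc_inr_inr spr_axEc decays_coDressKBmAt_KInvStep shiftK_coDressKBmAt_KInvStep coDressKBmAt_KInvStep_inr_row_off)
open Summit.QuantumFields.BalabanUV.Beta.BorderedHessian (bhK bhK_inl_inl bhK_inl_inr bhK_inr_inl bhK_inr_inr bhK_inr_row_off spr_bhK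
  sgnF sgnF_inl sgnF_inr sgnK_apply trK_bhK relInv_coDressKBmAt_KInvStep_zero)
open Summit.QuantumFields.BalabanUV.Beta.RelInvCombBorderedKKT (isUnit_det_kkt_fromRows_of_relInv blocks_kkt_fromRows_of_relInv)
open Summit.QuantumFields.BalabanUV.Beta.D1BFx.FibredPeriodisation
open Summit.QuantumFields.BalabanUV.Beta.D1BFx.SortedKernels
open Summit.QuantumFields.BalabanUV.Beta.D1BFx.SortedReblocking
open Summit.QuantumFields.BalabanUV.Beta.D1BFx.SortedPack
open Summit.QuantumFields.BalabanUV.Beta.D1BFx.SortedRelInv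
open scoped BigOperators

variable {d : ℕ}

/-! ## §1 The torus comb functional -/

section Comb
variable (ρ : Fin (d + 1) → ℤ) (n p : ℕ) [NeZero n] [NeZero p]

/-- [our object] The index of the torus fine bonds over the coarse torus: (coarse torus point, in-block position, direction). -/
abbrev I (d n p : ℕ) [NeZero n] [NeZero p] : Type := Beta.Site (d + 1) p × (TorusSite (d + 1) n × Fin (d + 1))

/-- [our object] The index of the torus coarse bonds: (coarse torus point, direction). -/
abbrev J (d p : ℕ) [NeZero p] : Type := Beta.Site (d + 1) p × Fin (d + 1)

/-- [our object] The comb rows: the comb bonds of the torus. -/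
abbrev CombRows : Type := {i : I d n p // IsCombBondAt ρ n i.2.2 (repZ i.2.1)}

open Classical in
/-- [our object] Finiteness of the comb rows (classical decidability of the comb predicate). -/
instance instFintypeCombRows : Fintype (CombRows ρ n p) := Subtype.fintype _

/-- [our object] Decidable equality of the comb rows, registered as a named instance (the structural `Subtype` instance over the triple
product is not found by nested instance search inside `Sum` types at the default synthesis budget). -/
instance instDecEqCombRows : DecidableEq (CombRows ρ n p) := inferInstance

/-- [our object] **THE TORUS COMB FUNCTIONAL** `τ_T`: the coordinate rows of the comb bonds. -/
def tauT : Matrix (CombRows ρ n p) (I d n p) ℝ := fun r i => if i = r.1 then 1 else 0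

/-- [our object] Entries of `τ_T`. -/
theorem tauT_apply (r : CombRows ρ n p) (i : I d n p) : tauT ρ n p r i = if i = r.1 then 1 else 0 := rfl

/-- [folklore] `τ_T·τ_Tᵀ = 1` (coordinate rows are orthonormal). -/
theorem tauT_mul_transpose : tauT ρ n p * (tauT ρ n p)ᵀ = 1 := by
  ext r r'
  rw [Matrix.mul_apply, Matrix.one_apply]
  simp only [Matrix.transpose_apply, tauT_apply]
  rw [Finset.sum_eq_single r.1]
  · by_cases h : r = r'
    · subst h; simp
    · have h' : r.1 ≠ r'.1 := fun e => h (Subtype.ext e)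
      simp [h, h']
  · intro i _ hi; simp [hi]
  · intro h; exact absurd (Finset.mem_univ _) h

open Classical in
/-- [folklore] `(τ_Tᵀ·τ_T) i j = [i = j ∧ i is a comb bond]` (the diagonal indicator of the comb bonds). -/
theorem transpose_mul_tauT_apply (i j : I d n p) :
    ((tauT ρ n p)ᵀ * tauT ρ n p) i j = if i = j ∧ IsCombBondAt ρ n i.2.2 (repZ i.2.1) then 1 else 0 := by
  rw [Matrix.mul_apply]
  simp only [Matrix.transpose_apply, tauT_apply]
  by_cases hi : IsCombBondAt ρ n i.2.2 (repZ i.2.1)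
  · rw [Finset.sum_eq_single (⟨i, hi⟩ : CombRows ρ n p)]
    · by_cases hij : i = j
      · subst hij; simp [hi]
      · simp [hij, hi, Ne.symm hij]
    · intro r _ hr
      have : i ≠ r.1 := fun e => hr (Subtype.ext e.symm)
      simp [this]
    · intro h; exact absurd (Finset.mem_univ _) h
  · rw [if_neg (fun h => hi h.2)]
    refine Finset.sum_eq_zero fun r _ => ?_
    have : i ≠ r.1 := fun e => hi (e ▸ r.2)
    simp [this]

open Classical in
/-- [folklore] `(1 − τ_Tᵀ·τ_T) i j = [i = j ∧ i is NOT a comb bond]`. -/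
theorem one_sub_transpose_mul_tauT_apply (i j : I d n p) :
    ((1 : Matrix (I d n p) (I d n p) ℝ) - (tauT ρ n p)ᵀ * tauT ρ n p) i j = if i = j ∧ ¬ IsCombBondAt ρ n i.2.2 (repZ i.2.1) then 1 else 0 := by
  rw [Matrix.sub_apply, Matrix.one_apply, transpose_mul_tauT_apply]
  by_cases hij : i = j
  · subst hij
    by_cases hc : IsCombBondAt ρ n i.2.2 (repZ i.2.1) <;> simp [hc]
  · simp [hij]

end Comb

/-! ## §2 The periodised coarse axial coordinate projector is `fromBlocks (1 − τ_Tᵀτ_T) 0 0 1` -/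

section AxEc
variable (ρ : Fin (d + 1) → ℤ) (n p : ℕ) [NeZero n] [NeZero p]

/-- [folklore] Comb-ness of a fine bond depends only on its in-block position. -/
theorem isCombBondAt_finePt_iff (m : Fin (d + 1)) (y : Fin (d + 1) → ℤ) (z : TorusSite (d + 1) n) :
    IsCombBondAt ρ n m (finePt n y z) ↔ IsCombBondAt ρ n m (repZ z) := by
  rw [finePt]; exact isCombBondAt_add_zsmul ρ m (repZ z) y

/-- [folklore] The periodisation of a multiple of the Kronecker kernel. -/
theorem periodise₂_const_mul_kdelta (c : ℝ) (x y : Beta.Site (d + 1) p) :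
    periodise₂ p (fun a b => c * kdelta (d := d + 1) a b) x y = if x = y then c else 0 := by
  rw [periodise₂_const_mul, periodise₂_kdelta]
  split_ifs <;> simp

open Classical in
/-- [folklore] ff fibres of the sorted `axEc`: a multiple of the Kronecker kernel. -/
theorem Kfib_sortK_axEc_inl_inl (z z' : TorusSite (d + 1) n) (α β : Fin (d + 1)) :
    Kfib (sortK n (axEc ρ n)) (Sum.inl (z, α)) (Sum.inl (z', β))
      = fun y y' => (if z = z' ∧ α = β ∧ ¬ IsCombBondAt ρ n α (repZ z) then (1 : ℝ) else 0) * kdelta y y' := by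
  funext y y'
  rw [Kfib_sortK, ι_inl, ι_inl, Kfib_reblock, axEc_inl_inl]
  simp only [finePt_eq_iff, isCombBondAt_finePt_iff, kdelta]
  by_cases hy : y = y' <;> by_cases hz : z = z' <;> by_cases hab : α = β <;> by_cases hc : IsCombBondAt ρ n α (repZ z) <;>
    simp [hy, hz, hab, hc]

open Classical in
/-- [folklore] mm fibres of the sorted `axEc`: the Kronecker kernel of the coarse sort. -/
theorem Kfib_sortK_axEc_inr_inr (m m' : Fin (d + 1)) :
    Kfib (sortK n (axEc ρ n)) (Sum.inr m) (Sum.inr m')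
      = fun y y' => (if m = m' then (1 : ℝ) else 0) * kdelta y y' := by
  funext y y'
  rw [Kfib_sortK, ι_inr, ι_inr, Kfib_reblock, axEc_inr_inr]
  simp only [finePt_eq_iff, proj_finePt, kdelta, and_true]
  by_cases hy : y = y' <;> by_cases hm : m = m' <;> simp [hy, hm]

omit [NeZero n] [NeZero p] in
/-- [folklore] fm fibres of the sorted `axEc` vanish. -/
theorem Kfib_sortK_axEc_inl_inr (z : TorusSite (d + 1) n) (α m : Fin (d + 1)) :
    Kfib (sortK n (axEc ρ n)) (Sum.inl (z, α)) (Sum.inr m) = fun _ _ => (0 : ℝ) := by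
  funext y y'
  rw [Kfib_sortK, ι_inl, ι_inr, Kfib_reblock, axEc_inl_inr]

omit [NeZero n] [NeZero p] in
/-- [folklore] mf fibres of the sorted `axEc` vanish. -/
theorem Kfib_sortK_axEc_inr_inl (m : Fin (d + 1)) (z : TorusSite (d + 1) n) (β : Fin (d + 1)) :
    Kfib (sortK n (axEc ρ n)) (Sum.inr m) (Sum.inl (z, β)) = fun _ _ => (0 : ℝ) := by
  funext y y'
  rw [Kfib_sortK, ι_inr, ι_inl, Kfib_reblock, axEc_inr_inl]

open Classical in
/-- [folklore] **`Ê = fromBlocks (1 − τ_Tᵀτ_T) 0 0 1`**: the torus block matrix of the sorted coarse axial coordinate projector is the model's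
coordinate projector for the torus comb functional. -/
theorem blocksHat_sortK_axEc :
    blocksHat p (sortK n (axEc ρ n))
      = Matrix.fromBlocks ((1 : Matrix (I d n p) (I d n p) ℝ) - (tauT ρ n p)ᵀ * tauT ρ n p) 0 0 (1 : Matrix _ _ ℝ) := by
  rw [blocksHat]
  congr 1
  · ext ⟨x, z, α⟩ ⟨y, z', β⟩
    rw [Matrix.of_apply, one_sub_transpose_mul_tauT_apply, show fTL (sortK n (axEc ρ n)) = fTL (sortK n (axEc ρ n)) from rfl,
      periodiseF_apply, show Kfib (fTL (sortK n (axEc ρ n))) (z, α) (z', β) = Kfib (sortK n (axEc ρ n)) (Sum.inl (z, α)) (Sum.inl (z', β))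
        from rfl, Kfib_sortK_axEc_inl_inl, periodise₂_const_mul_kdelta]
    simp only [Prod.mk.injEq]
    by_cases hx : x = y <;> by_cases hz : z = z' <;> by_cases hab : α = β <;> by_cases hc : IsCombBondAt ρ n α (repZ z) <;>
      simp [hx, hz, hab, hc]
  · ext ⟨x, z, α⟩ ⟨y, m⟩
    rw [Matrix.of_apply, Matrix.zero_apply, periodiseF_apply, show Kfib (fTR (sortK n (axEc ρ n))) (z, α) m
      = Kfib (sortK n (axEc ρ n)) (Sum.inl (z, α)) (Sum.inr m) from rfl, Kfib_sortK_axEc_inl_inr, periodise₂_zero]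
  · ext ⟨x, m⟩ ⟨y, z, β⟩
    rw [Matrix.of_apply, Matrix.zero_apply, periodiseF_apply, show Kfib (fBL (sortK n (axEc ρ n))) m (z, β)
      = Kfib (sortK n (axEc ρ n)) (Sum.inr m) (Sum.inl (z, β)) from rfl, Kfib_sortK_axEc_inr_inl, periodise₂_zero]
  · ext ⟨x, m⟩ ⟨y, m'⟩
    rw [Matrix.of_apply, Matrix.one_apply, periodiseF_apply, show Kfib (fBR (sortK n (axEc ρ n))) m m'
      = Kfib (sortK n (axEc ρ n)) (Sum.inr m) (Sum.inr m') from rfl, Kfib_sortK_axEc_inr_inr, periodise₂_const_mul_kdelta]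
    simp only [Prod.mk.injEq]
    by_cases hx : x = y <;> by_cases hm : m = m' <;> simp [hx, hm]

end AxEc

/-! ## §3 The periodised undressed bordered Hessian is `kkt K̂ Q̂ · diag(1, −1)` -/

section BhK
variable (n p : ℕ) [NeZero n] [NeZero p]

/-- [our object] `K̂`: the torus matrix of `d*d` (ff block of `bhK`, fine bonds re-blocked over the coarse torus). -/
def Khat : Matrix (I d n p) (I d n p) ℝ := Matrix.of (periodiseF p (fTL (sortK n (bhK (d := d) n))))

/-- [our object] `Q̂`: the torus matrix of the straight block averaging `𝒬` (mf block of `bhK`: coarse bonds × fine bonds). -/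
def Qhat : Matrix (J d p) (I d n p) ℝ := Matrix.of (periodiseF p (fBL (sortK n (bhK (d := d) n))))

/-- [folklore] The fm block of `bhK` is MINUS the transpose of its mf block (`trK_bhK`), in sorted form. -/
theorem fTR_sortK_bhK : fTR (sortK n (bhK (d := d) n)) = fun i j => -(trF (fBL (sortK n (bhK (d := d) n))) i j) := by
  funext ⟨y, z, κ⟩ ⟨y', l⟩
  rw [trF_apply]
  show sortK n (bhK n) (y, Sum.inl (z, κ)) (y', Sum.inr l) = -(sortK n (bhK n) (y', Sum.inr l) (y, Sum.inl (z, κ)))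
  rw [sortK_inl_inr, sortK_inr_inl]
  have h := congrFun (congrFun (congrFun (congrFun (trK_bhK (d := d) n) (finePt n y z)) ((n : ℤ) • y')) (Sum.inl κ)) (Sum.inr l)
  rw [trK_apply, sgnK_apply, sgnF_inl, sgnF_inr] at h
  rw [h]; ring

omit [NeZero n] [NeZero p] in
/-- [folklore] The mm block of `bhK` vanishes, in sorted form. -/
theorem fBR_sortK_bhK : fBR (sortK n (bhK (d := d) n)) = fun _ _ => (0 : ℝ) := by
  funext ⟨y, m⟩ ⟨y', m'⟩
  show sortK n (bhK n) (y, Sum.inr m) (y', Sum.inr m') = 0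
  rw [sortK_inr_inr, bhK_inr_inr]

/-- [folklore] Periodisation of a negated kernel. -/
theorem periodiseF_neg {α β : Type*} (K : FKer (d + 1) α β) (i : Beta.Site (d + 1) p × α) (j : Beta.Site (d + 1) p × β) :
    periodiseF p (fun i' j' => -K i' j') i j = -periodiseF p K i j := by
  obtain ⟨x, a⟩ := i
  obtain ⟨y, b⟩ := j
  simp only [periodiseF_apply, periodise₂, Kfib_apply]
  exact tsum_neg

/-- [folklore] Block covariance of the sorted `bhK`: jointly periodic fibres. -/
theorem isPeriodic₂_sortK_bhK (q : ℕ) : ∀ i j, IsPeriodic₂ q (Kfib (sortK n (bhK (d := d) n)) i j) :=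
  isPeriodic₂_sortK (fun t => shiftK_bhK t) q

/-- [folklore] **`(sortK n (bhK n))^ = kkt K̂ Q̂ · fromBlocks 1 0 0 (−1)`** — the undressed bordered Hessian `[[d*d, −𝒬ᵀ],[𝒬, 0]]` on the torus is the
model's `kkt` with the sign of the multiplier COLUMNS flipped. -/
theorem blocksHat_sortK_bhK :
    blocksHat p (sortK n (bhK (d := d) n))
      = kkt (Khat (d := d) n p) (Qhat (d := d) n p) * Matrix.fromBlocks (1 : Matrix (I d n p) (I d n p) ℝ) 0 0 (-1 : Matrix (J d p) (J d p) ℝ) := by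
  rw [kkt, Matrix.fromBlocks_multiply]
  simp only [Matrix.mul_one, Matrix.mul_zero, add_zero, zero_add, Matrix.mul_neg, neg_zero]
  rw [blocksHat]
  congr 1
  · -- fm block: `−Q̂ᵀ`
    ext ⟨x, z, κ⟩ ⟨y, l⟩
    rw [Matrix.neg_apply, Matrix.transpose_apply, Qhat, Matrix.of_apply, Matrix.of_apply, fTR_sortK_bhK, periodiseF_neg,
      periodiseF_trF_apply (fun a b => isPeriodic₂_sortK_bhK n p (Sum.inr a) (Sum.inl b))]
  · -- mm block: `0`
    rw [fBR_sortK_bhK, periodiseF_zero]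

end BhK

/-! ## §4 `M_T` is invertible and its ff block is the periodised dressed leg -/

/-- [folklore] The `(ν ⊕ μ)`-corner read two ways: through `Sum.map id Sum.inl` (TA4's `mixedVar_kkt_fromRows_zero`) and through the
re-association `Equiv.sumAssoc` (an2-g23's `kkt_fromRows_submatrix_sumAssoc`). -/
theorem submatrix_map_inl_eq_toBlocks₁₁ {ν μ ρ' : Type*} (X : Matrix (ν ⊕ (μ ⊕ ρ')) (ν ⊕ (μ ⊕ ρ')) ℝ) :
    X.submatrix (Sum.map id Sum.inl) (Sum.map id Sum.inl) = (X.submatrix (Equiv.sumAssoc ν μ ρ') (Equiv.sumAssoc ν μ ρ')).toBlocks₁₁ := by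
  ext a b
  rcases a with i | j <;> rcases b with i' | j' <;> rfl

section Main
variable {n : ℕ} [NeZero n] {r : Fin (d + 1) → ℕ} (hr : r ∈ box (d + 1) n) (p : ℕ) [NeZero p]
include hr

omit hr in
/-- [folklore] The sign matrix `diag(1, −1)` commutes with the coordinate projector `fromBlocks E₁ 0 0 1`. -/
theorem sg_comm_E (E₁ : Matrix (I d n p) (I d n p) ℝ) :
    Matrix.fromBlocks E₁ 0 0 (1 : Matrix (J d p) (J d p) ℝ) * Matrix.fromBlocks (1 : Matrix (I d n p) (I d n p) ℝ) 0 0 (-1 : Matrix (J d p) (J d p) ℝ)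
      = Matrix.fromBlocks (1 : Matrix (I d n p) (I d n p) ℝ) 0 0 (-1 : Matrix (J d p) (J d p) ℝ) * Matrix.fromBlocks E₁ 0 0 (1 : Matrix (J d p) (J d p) ℝ) := by
  rw [Matrix.fromBlocks_multiply, Matrix.fromBlocks_multiply]
  simp

/-- [folklore] **TB1 (M-SIDE): THE TORUS COMB-GAUGED SHARP KKT MATRIX IS INVERTIBLE** — `IsUnit (kkt K̂ (fromRows Q̂ τ_T)).det` on every coarse torus,
for every block side `n ≥ 1` with in-block root and every coarse period `p ≥ 1`. -/
theorem isUnit_det_MT :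
    IsUnit (kkt (Khat (d := d) n p) (Matrix.fromRows (Qhat (d := d) n p) (tauT (toSite r) n p))).det := by
  obtain ⟨h1, -, -, h4⟩ := torus_rules_wall (d := d) hr p
  rw [blocksHat_sortK_axEc] at h1 h4
  rw [blocksHat_sortK_bhK] at h4
  set G := blocksHat p (sortK n (coDressKBmAt (toSite r) n (KInvStep (d := d) n 0))) with hG
  set Sg : Matrix _ _ ℝ := Matrix.fromBlocks (1 : Matrix (I d n p) (I d n p) ℝ) 0 0
    (-1 : Matrix (J d p) (J d p) ℝ) with hSg
  refine isUnit_det_kkt_fromRows_of_relInv (Khat n p) (Qhat n p) (tauT (toSite r) n p) (tauT_mul_transpose _ n p)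
    (A := Sg * G) ?_ ?_
  · rw [← Matrix.mul_assoc, sg_comm_E, Matrix.mul_assoc, h1]
  · rw [Matrix.mul_assoc, ← Matrix.mul_assoc (kkt _ _), ← Matrix.mul_assoc]
    exact h4

/-- [folklore] **TB1 (M-SIDE): THE ff BLOCK OF `M_T⁻¹` IS THE PERIODISED DRESSED LEG** —
`flucCov K̂ (fromRows Q̂ τ_T) = (reblock n (blk G true true))^`, `G := coDressKBmAt (toSite r) n (KInvStep n 0)` (the Π_bm-dressed one-step
resolvent; its dictionary `= Π_bm Γ_R Π_bmᵀ − …` is `LandauDictionaryInstance` + `BlockMeanBlindnessLegs`, composed in TB5). -/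
theorem flucCov_MT_eq :
    flucCov (Khat (d := d) n p) (Matrix.fromRows (Qhat (d := d) n p) (tauT (toSite r) n p))
      = Matrix.of (periodiseF p (reblock n (PackedKernelSplit.blk (coDressKBmAt (toSite r) n (KInvStep (d := d) n 0)) true true))) := by
  obtain ⟨h1, -, -, h4⟩ := torus_rules_wall (d := d) hr p
  rw [blocksHat_sortK_axEc] at h1 h4
  rw [blocksHat_sortK_bhK] at h4
  set G := blocksHat p (sortK n (coDressKBmAt (toSite r) n (KInvStep (d := d) n 0))) with hG
  set Sg : Matrix _ _ ℝ := Matrix.fromBlocks (1 : Matrix (I d n p) (I d n p) ℝ) 0 0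
    (-1 : Matrix (J d p) (J d p) ℝ) with hSg
  have hEA : Matrix.fromBlocks (1 - (tauT (toSite r) n p)ᵀ * tauT (toSite r) n p) 0 0 1 * (Sg * G) = Sg * G := by
    rw [← Matrix.mul_assoc, sg_comm_E, Matrix.mul_assoc, h1]
  have hEMA : Matrix.fromBlocks (1 - (tauT (toSite r) n p)ᵀ * tauT (toSite r) n p) 0 0 1 * kkt (Khat n p) (Qhat n p) * (Sg * G)
      = Matrix.fromBlocks (1 - (tauT (toSite r) n p)ᵀ * tauT (toSite r) n p) 0 0 1 := by
    rw [Matrix.mul_assoc, ← Matrix.mul_assoc (kkt _ _), ← Matrix.mul_assoc]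
    exact h4
  have hb := (blocks_kkt_fromRows_of_relInv (Khat n p) (Qhat n p) (tauT (toSite r) n p) (tauT_mul_transpose _ n p) hEA hEMA).1
  rw [hb, hSg, hG, blocksHat, Matrix.fromBlocks_multiply]
  simp only [Matrix.one_mul, Matrix.zero_mul, add_zero, Matrix.toBlocks_fromBlocks₁₁, fTL_sortK]

set_option synthInstance.maxSize 512 in
/-- [folklore] **TB1 (M-SIDE), TA4's LEG SOCKET FILLED: THE PACKED `(fine ⊕ coarse)` CORNER OF `M_T⁻¹` IS THE PERIODISED Π_bm-DRESSED PACK**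
(with the sign of the multiplier ROWS flipped — the `[[δd, −𝒬ᵀ],[𝒬, 0]]` vs `kkt` convention, `BorderedHessianSymmetry`):
`(kkt K̂ (fromRows Q̂ τ_T))⁻¹.submatrix e e = fromBlocks 1 0 0 (−1) · (sortK n G)^`, `e = Sum.map id Sum.inl`, `G := coDressKBmAt (toSite r) n (KInvStep n 0)`.
(The instance budget is raised for `DecidableEq ((I ⊕ J) ⊕ CombRows)` — three nested index products.) -/
theorem inv_MT_packed_eq :
    (kkt (Khat (d := d) n p) (Matrix.fromRows (Qhat (d := d) n p) (tauT (toSite r) n p)))⁻¹.submatrix (Sum.map id Sum.inl) (Sum.map id Sum.inl)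
      = Matrix.fromBlocks (1 : Matrix (I d n p) (I d n p) ℝ) 0 0 (-1 : Matrix (J d p) (J d p) ℝ)
          * blocksHat p (sortK n (coDressKBmAt (toSite r) n (KInvStep (d := d) n 0))) := by
  obtain ⟨h1, -, -, h4⟩ := torus_rules_wall (d := d) hr p
  rw [blocksHat_sortK_axEc] at h1 h4
  rw [blocksHat_sortK_bhK] at h4
  set G := blocksHat p (sortK n (coDressKBmAt (toSite r) n (KInvStep (d := d) n 0))) with hG
  set Sg : Matrix _ _ ℝ := Matrix.fromBlocks (1 : Matrix (I d n p) (I d n p) ℝ) 0 0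
    (-1 : Matrix (J d p) (J d p) ℝ) with hSg
  set τ := tauT (toSite r) n p with hτ
  have hEA : Matrix.fromBlocks (1 - τᵀ * τ) 0 0 1 * (Sg * G) = Sg * G := by
    rw [← Matrix.mul_assoc, sg_comm_E, Matrix.mul_assoc, h1]
  have hEMA : Matrix.fromBlocks (1 - τᵀ * τ) 0 0 1 * kkt (Khat n p) (Qhat n p) * (Sg * G) = Matrix.fromBlocks (1 - τᵀ * τ) 0 0 1 := by
    rw [Matrix.mul_assoc, ← Matrix.mul_assoc (kkt _ _), ← Matrix.mul_assoc]
    exact h4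
  have hT : (Matrix.fromRows τᵀ (0 : Matrix (J d p) (CombRows (toSite r) n p) ℝ))ᵀ
      * Matrix.fromRows τᵀ (0 : Matrix (J d p) (CombRows (toSite r) n p) ℝ) = 1 := by
    rw [RelInvCombBorderedKKT.transpose_fromRows_mul_fromRows, hτ, tauT_mul_transpose]
  have hE := (RelInvCombBorderedKKT.one_sub_fromRows_mul_transpose (μ := J d p) τ).symm
  have hc := RelInvCombBorderedKKT.toBlocks₁₁_inv_combBordered (M := kkt (Khat n p) (Qhat n p)) hT hE hEA hEMA
  rw [← RelInvCombBorderedKKT.kkt_fromRows_submatrix_sumAssoc, Matrix.inv_submatrix_equiv] at hc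
  rw [submatrix_map_inl_eq_toBlocks₁₁, hc]

end Main

end Summit.QuantumFields.BalabanUV.Beta.D1BFx.TorusCombKKT

end
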